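import Summits.QuantumFields.BalabanUV.Gaps.D1IndexSymmetryDictionary
import Summits.QuantumFields.BalabanUV.Beta.D1BFx.PermCovariantReynolds

/-!
# `BalabanUV.Gaps.D1ReynoldsMeanPairs` — cell pub-balaban-gaps, row (D1), seat g1-p1: THE S₄-REYNOLDS MEAN OF THE TWO LITERALS' STEP KERNELS — permutation-covariant (leaf-01), INDEX-SYMMETRIC
# (GEN 14's (5.8) passes to the mean), and its (1.22) coefficient at ANY off-diagonal pair is the average of the SIX unordered pair values `β⁰_j({a,b})` of the literal (twelve ordered
# values, halved by (5.8))

HONEST FRAMING (cell rule, page 1 of everything): [folklore] kernel algebra BY NAME — leaf-01 g37's `D1BFx.PermCovariantReynolds` (`reynoldsMean`, `permCovariant_reynoldsMean`,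
`indexSymmetric_reynoldsMean`, `card_pairs_mul_secondMoment_reynoldsMean`), GEN 14's `indexSymmetric_flipK_TbalOf_JsBalAn1 ∕ _JsB12CombShSym`, `secondMoment_TbalOf_…_comm` and
`momentSummable_flipK_TbalOf`.  The Reynolds mean is a KERNEL-LEVEL average ([our object] of leaf-01, «NOT the kernel of averaged jets»); which literal the β row wants is the OWNER's
ruling (Q-an2-g55-1), not touched here; NOTHING of Bałaban's asserted; NO coefficient computed or signed; (D1) NOT discharged; 0∕4 row-D1 binders; NOT `BetaPertH`, NOT continuum, NOT Clay.
HONEST DEPENDENCY (b2b cell, verbatim): «continuum YM on T⁴ ⇐ BetaPertH ∧ nine spine estimates (0/9 proved); BetaPertH ⇐ (D1) ∧ (D4) ∧ CAP+tail; G-an2-4 gates asym, D1 and NE2/3/4.»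

CONTENT (all [folklore]; no `def`, 0 sorry): §1 generic — `sum_pairs_eq_two_mul_of_symm` (a symmetric off-diagonal pair sum is twice the sum over `a < b`); §2 the pinned literal
`P := flipK (TbalOf Lc (JsBalAn1 …) j)`: `indexSymmetric_reynoldsMean_JsBalAn1`, `summable_secondMoment_flipK_TbalOf` (from §1 of the dictionary file),
**`twelve_mul_secondMoment_reynoldsMean_JsBalAn1`** (`12 · secondMoment (reynoldsMean P) μ ν = Σ_{a ≠ b} secondMoment P a b`), **`six_mul_secondMoment_reynoldsMean_JsBalAn1`**
(`6 · secondMoment (reynoldsMean P) μ ν = Σ_{a < b} secondMoment P a b`); §3 the same two at the (III′) literal over every table record.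

Provenance: cell pub-balaban-gaps, seat g1-p1 GEN 14 (prover-pub-balaban-gaps-g1-p1-g14-0), 2026-08-25; no existing file touched.
-/

noncomputable section

open Literature.MathematicalPhysics.QuantumFieldTheory Balaban1983to89 Balaban1983to89.Beta Filter Topology
open OneStepResolventKernel (JetData)
open OneStepKernelFamily (TbalOf flipK)
open PolarizationSign (IndexSymmetric MomentSummable)
open AffineAveraging (box)
open Summit.QuantumFields.BalabanUV.Beta.SymmetrisedStepJets (SymTables)
open Summit.QuantumFields.BalabanUV.Beta.MixedJetTablesPlug (JsBalAn1)
open Summit.QuantumFields.BalabanUV.Beta.CombChartJointEnd (JsB12CombShSym)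
open Summit.QuantumFields.BalabanUV.Beta.D1BFx.PermCovariantReynolds (reynoldsMean permCovariant_reynoldsMean indexSymmetric_reynoldsMean card_pairs_mul_secondMoment_reynoldsMean)
open Summit.QuantumFields.BalabanUV.Gaps.D1PinnedIndexSymmetry (indexSymmetric_flipK_TbalOf_JsBalAn1)
open Summit.QuantumFields.BalabanUV.Gaps.D1RecordIndexSymmetry (indexSymmetric_flipK_TbalOf_JsB12CombShSym)
open Summit.QuantumFields.BalabanUV.Gaps.D1IndexSymmetryDictionary (momentSummable_flipK_TbalOf)

namespace Summit.QuantumFields.BalabanUV.Gaps.D1ReynoldsMeanPairs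

variable {Lc : ℕ} [NeZero Lc]

/-! ## §1 Generic bookkeeping -/

/-- [folklore] In dimension four the number of ordered off-diagonal direction pairs is `12`. -/
theorem sum_pairs_indicator_four : (∑ a : Fin 4, ∑ b : Fin 4, if a = b then (0 : ℝ) else 1) = 12 := by
  simp only [Fin.sum_univ_four, Fin.isValue, Fin.reduceEq, ↓reduceIte]
  norm_num

/-- [folklore] Summable (1.22) integrands of every channel of a kernel with summable third moments (`MomentSummable P 3` is more than enough). -/
theorem summable_secondMoment_of_momentSummable {d : ℕ} {P : B12Beta.Kernel d} (hP : MomentSummable P 3) (μ ν : Fin d) :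
    Summable fun x : Fin d → ℤ => P μ ν x * (x μ : ℝ) * (x ν : ℝ) := by
  have h := hP.summable_mul μ ν 1 (w := fun x => (x μ : ℝ) * (x ν : ℝ)) (fun z => by
    rw [abs_mul, one_mul, pow_succ, pow_two]
    refine mul_le_mul ?_ (PolarizationSign.abs_apply_le_size z ν) (abs_nonneg _)
      (mul_nonneg (PolarizationSign.size_pos z).le (PolarizationSign.size_pos z).le)
    exact (PolarizationSign.abs_apply_le_size z μ).trans (by nlinarith [PolarizationSign.one_le_size z]))
  exact h.congr fun x => by ring

/-- [folklore] For an index-symmetric kernel the ordered off-diagonal pair sum of (1.22) is TWICE the sum over the six unordered pairs `a < b` (`PolarizationSign.secondMoment_comm`). -/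
theorem sum_pairs_secondMoment_eq_two_mul {P : B12Beta.Kernel 4} (hI : IndexSymmetric P) :
    (∑ a : Fin 4, ∑ b : Fin 4, if a = b then (0 : ℝ) else B12Beta.secondMoment P a b) =
      2 * ∑ a : Fin 4, ∑ b : Fin 4, if a < b then B12Beta.secondMoment P a b else 0 := by
  have hs : ∀ a b : Fin 4, B12Beta.secondMoment P b a = B12Beta.secondMoment P a b := fun a b => (PolarizationSign.secondMoment_comm hI a b).symm
  simp only [Fin.sum_univ_four, Fin.isValue, Fin.reduceEq, ↓reduceIte, Fin.reduceLT, hs]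
  norm_num
  ring

/-! ## §2 The β-lead's pinned family -/

section Pinned

variable {r : Fin (3 + 1) → ℕ}

/-- [folklore] The Reynolds mean of the pinned literal's flipped step kernel is INDEX-SYMMETRIC ((5.8) passes to the mean, leaf-01's `indexSymmetric_reynoldsMean`) — and permutation-covariant by
construction (`permCovariant_reynoldsMean`). -/
theorem indexSymmetric_reynoldsMean_JsBalAn1 (hLc : 1 ≤ Lc) (hr : r ∈ box (3 + 1) Lc) (cE cVH cΛ cE₂ cB : ℝ) (T : Fin 4 → Fin 4 → Fin 4 → Fin 4 → ℝ) (j : ℕ) :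
    IndexSymmetric (reynoldsMean (flipK (TbalOf Lc (JsBalAn1 hLc hr cE cVH cΛ cE₂ cB T) j))) :=
  indexSymmetric_reynoldsMean (indexSymmetric_flipK_TbalOf_JsBalAn1 hLc hr cE cVH cΛ cE₂ cB T j)

/-- [folklore] **TWELVE TIMES THE MEAN's (1.22) IS THE ORDERED PAIR SUM** for the pinned literal (`μ ≠ ν`; leaf-01's `card_pairs_mul_secondMoment_reynoldsMean` with the summability of §1). -/
theorem twelve_mul_secondMoment_reynoldsMean_JsBalAn1 (hLc : 1 ≤ Lc) (hr : r ∈ box (3 + 1) Lc) (cE cVH cΛ cE₂ cB : ℝ) (T : Fin 4 → Fin 4 → Fin 4 → Fin 4 → ℝ) (j : ℕ)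
    {μ ν : Fin 4} (hμν : μ ≠ ν) :
    12 * B12Beta.secondMoment (reynoldsMean (flipK (TbalOf Lc (JsBalAn1 hLc hr cE cVH cΛ cE₂ cB T) j))) μ ν =
      ∑ a : Fin 4, ∑ b : Fin 4, if a = b then (0 : ℝ) else B12Beta.secondMoment (flipK (TbalOf Lc (JsBalAn1 hLc hr cE cVH cΛ cE₂ cB T) j)) a b := by
  have h := card_pairs_mul_secondMoment_reynoldsMean
    (summable_secondMoment_of_momentSummable (momentSummable_flipK_TbalOf (JsBalAn1 hLc hr cE cVH cΛ cE₂ cB T) j 3)) hμν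
  rwa [sum_pairs_indicator_four] at h

/-- [folklore] **SIX TIMES THE MEAN's (1.22) IS THE UNORDERED PAIR SUM** for the pinned literal: `6 · secondMoment (reynoldsMean P) μ ν = Σ_{a<b} secondMoment P a b` (`μ ≠ ν`) — by (5.8) the
twelve ordered values come in six equal pairs; a «pair-averaged hβ» at the pinned literal is the mean of SIX numbers. -/
theorem six_mul_secondMoment_reynoldsMean_JsBalAn1 (hLc : 1 ≤ Lc) (hr : r ∈ box (3 + 1) Lc) (cE cVH cΛ cE₂ cB : ℝ) (T : Fin 4 → Fin 4 → Fin 4 → Fin 4 → ℝ) (j : ℕ)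
    {μ ν : Fin 4} (hμν : μ ≠ ν) :
    6 * B12Beta.secondMoment (reynoldsMean (flipK (TbalOf Lc (JsBalAn1 hLc hr cE cVH cΛ cE₂ cB T) j))) μ ν =
      ∑ a : Fin 4, ∑ b : Fin 4, if a < b then B12Beta.secondMoment (flipK (TbalOf Lc (JsBalAn1 hLc hr cE cVH cΛ cE₂ cB T) j)) a b else 0 := by
  have h := twelve_mul_secondMoment_reynoldsMean_JsBalAn1 hLc hr cE cVH cΛ cE₂ cB T j hμν
  rw [sum_pairs_secondMoment_eq_two_mul (indexSymmetric_flipK_TbalOf_JsBalAn1 hLc hr cE cVH cΛ cE₂ cB T j)] at h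
  linarith

end Pinned

/-! ## §3 The b2b wall's (III′) literal over every table record -/

/-- [folklore] The Reynolds mean of the (III′) literal's flipped step kernel is index-symmetric (and permutation-covariant by construction). -/
theorem indexSymmetric_reynoldsMean_JsB12CombShSym (hLc : Odd Lc) (N : ℕ) (tabs : SymTables 3 Lc) (cΛ cB : ℝ) (j : ℕ) :
    IndexSymmetric (reynoldsMean (flipK (TbalOf Lc (JsB12CombShSym hLc N tabs cΛ cB) j))) :=
  indexSymmetric_reynoldsMean (indexSymmetric_flipK_TbalOf_JsB12CombShSym hLc N tabs cΛ cB j)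

/-- [folklore] **TWELVE TIMES THE MEAN's (1.22) IS THE ORDERED PAIR SUM** for the (III′) literal (`μ ≠ ν`). -/
theorem twelve_mul_secondMoment_reynoldsMean_JsB12CombShSym (hLc : Odd Lc) (N : ℕ) (tabs : SymTables 3 Lc) (cΛ cB : ℝ) (j : ℕ) {μ ν : Fin 4} (hμν : μ ≠ ν) :
    12 * B12Beta.secondMoment (reynoldsMean (flipK (TbalOf Lc (JsB12CombShSym hLc N tabs cΛ cB) j))) μ ν =
      ∑ a : Fin 4, ∑ b : Fin 4, if a = b then (0 : ℝ) else B12Beta.secondMoment (flipK (TbalOf Lc (JsB12CombShSym hLc N tabs cΛ cB) j)) a b := by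
  have h := card_pairs_mul_secondMoment_reynoldsMean
    (summable_secondMoment_of_momentSummable (momentSummable_flipK_TbalOf (JsB12CombShSym hLc N tabs cΛ cB) j 3)) hμν
  rwa [sum_pairs_indicator_four] at h

/-- [folklore] **SIX TIMES THE MEAN's (1.22) IS THE UNORDERED PAIR SUM** for the (III′) literal: `6 · secondMoment (reynoldsMean P) μ ν = Σ_{a<b} secondMoment P a b` (`μ ≠ ν`) — the by-value
content of a «pair-averaged hβ» at the literal of record is the mean of the SIX unordered channel values (the β row's T-e `spread₆` objects). -/
theorem six_mul_secondMoment_reynoldsMean_JsB12CombShSym (hLc : Odd Lc) (N : ℕ) (tabs : SymTables 3 Lc) (cΛ cB : ℝ) (j : ℕ) {μ ν : Fin 4} (hμν : μ ≠ ν) :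
    6 * B12Beta.secondMoment (reynoldsMean (flipK (TbalOf Lc (JsB12CombShSym hLc N tabs cΛ cB) j))) μ ν =
      ∑ a : Fin 4, ∑ b : Fin 4, if a < b then B12Beta.secondMoment (flipK (TbalOf Lc (JsB12CombShSym hLc N tabs cΛ cB) j)) a b else 0 := by
  have h := twelve_mul_secondMoment_reynoldsMean_JsB12CombShSym hLc N tabs cΛ cB j hμν
  rw [sum_pairs_secondMoment_eq_two_mul (indexSymmetric_flipK_TbalOf_JsB12CombShSym hLc N tabs cΛ cB j)] at h
  linarith

end Summit.QuantumFields.BalabanUV.Gaps.D1ReynoldsMeanPairs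

end
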